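import Summits.QuantumFields.BalabanUV.Beta.D1BFx.DiagBracketWordMass
import Summits.QuantumFields.BalabanUV.Beta.D1BFx.ColumnGaugeDefectRecord
import Summits.QuantumFields.BalabanUV.Beta.SymAveragingHessianCounts
import Summits.QuantumFields.BalabanUV.Beta.SymCorrectorFaceGauge

/-!
# `BalabanUV.Beta.D1BFx.ChartDefectRowMcolMass` — road «BF-x», binder row D1, PART 24-hyb HEAD (`ChartDefectHead` v1.1's rows), **THE COLUMN-MIXED ROW (mcol) IN MASS
# CURRENCY** (leaf-03 g33, TT27; the (mcol) twin of gan24-leaf-05 g62's K0-REST-ROW `StraightPinRestRow` and of leaf-01 g33's O-9∕O-10 `Dsh` rows): for ANY bounded leg `G`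
# (`Bdd G S`), the word `z ↦ ½·tadpole G (Wmix(Λ′; V_H) a 0 e z)` — the HEAD's (mcol) row AFTER the OWNER's `ChartDefectTwoPinsRest.tadpole_WMcol_record_eq` (TT23 at the record) — is
# a (5.10)-kernel in the coarse variable with a CLOSED constant and an `n`-FREE rate, hence its (1.22) second moment is absolutely summable and bounded:
# `Decay510 (…) (½·(S·(2·Gc(n)·M_H(n) + 2·Gc(n)·M_H(n)))) (n·σ)` for any rates `0 < σ ≤ min (κ′∕(4n)) (κ₀∕(16n))`, `σ ≤ δM∕2`, `0 < δM` — at `σ := min (κ′∕(4n)) (κ₀∕(16n))`,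
# `δM := 2σ` the rate `n·σ = min (κ₁₆₃(4)∕64) (κ₀∕16)` is `n`-FREE (`rate_nfree`); `Gc(n) = (2∕n⁴)·4C₄e^{κ′}·e^{r₀·(4n∕2)}` (`r₀ = κ′∕(4n)`, `κ′ = κ₁₆₃(4)∕4`) the UNIT column
# generator's envelope (leaf-01's locked weight ÷ `n⁴∕2`), `M_H(n) = 4·((n⁵)⁻¹(n³)⁻¹)·(4CΦe^{κ₀}e^{κ₀∕2}Zl 4(κ₀∕8))·(16·(2·ell(4,n)²·e^{4·4·n·δM})·Zl 4(δM∕2)²)` the σ-WEIGHTED `ℓ¹` mass of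
# `V_H = vertexOfM K₀ n (symHessFFAt ρ_c n)` (gan24-leaf-05 g61 C′ over an1's table letter).

WHY (the OWNER d1-p2 g25's N-g25-1, journal l.54036: «the currency is the road's PACKED∕MASS currency of PART 23, not sup·`Zl`»; my located note N-1 l.54593 §3): the (mcol) word is a
commutator `[Λ′ e z, V a 0] + [Λ′ a 0, V e z]` of a DIAGONAL kernel against a vertex family.  Read the diagonal factor in SUP — its symbol decays from its coarse point — and the
vertex factor in σ-WEIGHTED `ℓ¹` MASS around ITS coarse point: `mass([D_p, V_q]) ≤ 2·Gc·e^{−δ|p − q|₁}·M_σ(V_q)` as soon as `δ ≤ σ` (§1 `wmass_bracket_le`: the envelope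
`e^{−δ|x − p|}` is traded for `e^{−δ|p − q|}·e^{δ|x − q|}` and the second factor is absorbed by the weight).  No lattice volume `Zl` is paid at the trace (d1-leaf-04's
`decay510_tadpoleWord_of_mass`: `|tadpole G W| ≤ S·mass W`), and the decay in `z` is `e^{−δ·n·|z|₁}` — an `n`-FREE rate `n·δ`.

CONTENT (the generic `ℓ¹` half — `wmass_bracket_le`, `wmass_le_of_blk`, `decay510_bracketWord_of_wmass` — is the sibling TT27a `D1BFx/DiagBracketWordMass`).  (`d = 3`, the record; modulo the DISPLAYED leg letter `Bdd G S` and multiplier envelope `hΦ` — g61∕g62's sockets, verbatim): `abs_unitColGen_legSite_le` (leaf-01's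
`ColumnGaugeDefectRecord.abs_lockedWeight_record_le` ÷ `n⁴∕2`, read through the leg `legSite ρ_c` at the cost `e^{r₀·|ρ_c|₁} ≤ e^{κ₁₆₃(4)∕32}` — TT10 `l1_sub_legSite_le`, leaf-01 `l1_ctr_le`),
`wmass_vertexOfM_K₀_symHessFFAt_le` (g61 `mass_blk_vertexOfM_K₀_le_of_vertexFamily` over an1 `vertexFamily_symHessFFAt`, four blocks by §1), **`decay510_row_mcol_mass`**,
**`row_mcol_mass`** (the HEAD's binder shapes `(∀ a e, AbsMoment₂ …) ∧ |secondMoment … μ ν| ≤ C·Σ'|x|₁²e^{−rate·|x|₁}` — lit `absMoment₂_of_decay510`, `secondMoment_abs_le_of_decay510`).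
LOCATED COUNT (zero weight on rulings): `Gc ≍ n⁻⁴`, `M_H ≍ n⁻⁸·n²·Zl 4 σ² ≍ n²` ⇒ NET `≍ S·n⁻²` with an `n`-free rate — m-uniform AS FAR AS THIS FILE READS, the `n`-law of `S`
(the road kernel's sup) and of `CΦ` NOT claimed here.  NOT HERE: the (ms) row (its diagonal factor `Θ′` needs TT25's mass letter — a sibling file once TT25 is in the tree);
the (lamf) row (N-1 PS: the dressed column's interior envelope, Q-1); the identity (mcol) = this bracket (the OWNER's `ChartDefectTwoPinsRest` (iii) ∕ my TT23).

HONEST DEPENDENCY (cell records, verbatim): «continuum YM on T⁴ ⇐ BetaPertH ∧ nine spine estimates (0/9 proved); BetaPertH ⇐ (D1) ∧ (D4) ∧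
CAP+tail; G-an2-4 gates asym, D1 and NE2/3/4.»  HONEST FRAMING (cell contract, verbatim): «discharging `BetaPertH` makes Bałaban's UV stability
UNCONDITIONAL — a real constructive-QFT result; it is NOT the continuum limit and NOT the Clay problem.»  THIS MODULE is [folklore] `ℓ¹` ∕ (1.22) read-out bookkeeping BY NAME over
landed objects; the leg letter `Bdd G S` and the multiplier envelope `hΦ` are DISPLAYED hypotheses (their `n`-laws are NOT claimed); it prices ONE displayed row of the HEAD modulo
those letters — per-word INTERMEDIATE (an2 R-D1-g45-4 (3)), not the HEAD, not the END; no definition, no `def … : Prop`, nothing cited, 0 sorry.  0∕4 row-D1 binders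
(hW ∕ hR ∕ D1Tel ∕ D1Rep); (J1) ONE OPEN ROW (eight displayed rows); (K) NOT closed; NOT D1, NEVER «G-an2-4 closed», NOT `BetaPertH`, NOT continuum, NOT Clay.

ABSOLUTE RULE (cell charter, verbatim): «No internally-minted statement may enter as a cited fact. Every hypothesis is either kernel-proved in
this package or a verbatim quotation of a PUBLISHED theorem with page reference. The manuscript(s) under audit are NOT citable for their own
disputed steps — they are the thing under adjudication; programme-internal (2001/route/tribunal) claims are never citable.»

Unit `b2b-balaban-beta-d1-formalise-leaf-03` (gen 33), D1 formalisation swarm LEAF PROVER 03, road «BF-x»; 2026-08-23.  No existing file touched.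
v1.2 (gen 33, APPEND-ONLY; §1 byte-identical to v1.1 p372150): §2 `decay510_row_mcol_mass_of_wmass`, `row_mcol_mass_of_wmass` — the same row with the vertex mass a BINDER `hV`
(TT27a's `hVA ∕ hVE` socket exposed at the record, so that gan24-leaf-05 g63's «H-TABLE-MASS» letter plugs by term as well as §1's `Zl`-route letter; g63 W-2 ∕ my W-3, journal).
-/

noncomputable section

namespace Summit.QuantumFields.BalabanUV.Beta.D1BFx.ChartDefectRowMcolMass

open Finset
open scoped BigOperators
open Literature.MathematicalPhysics.QuantumFieldTheory
open Literature.MathematicalPhysics.QuantumFieldTheory.Balaban1983to89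
open Literature.MathematicalPhysics.QuantumFieldTheory.Balaban1983to89.Beta
open B12Sec2to5 (l1 l1_nonneg Decay510 secondMoment_abs_le_of_decay510)
open DecimatedMomentSummable (AbsMoment₂ absMoment₂_of_decay510)
open B4ContourShift (supNorm)
open B5Hk163Strip (kappa163 kappa163_pos)
open B5Hk163Decay (MG163)
open B4TorusKernel (periodConst)
open ExpKernelCalculus (Site MKer Zl VertexFamily comp tadpole l1_sub_triangle l1_sub_symm l1_natSmul)
open AveragingHessianKernels (ell)
open AveragingContoursRooted (ctr ctrOff ctrOff_mem_box)
open KernelSpecInstance (wΦ)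
open KernelWard (Bdd)
open OneStepResolventKernel (Fib)
open OneStepKernelFamily (colH KInvStep)
open SecondOrderResponse (vertexOfM)
open Summit.QuantumFields.BalabanUV.Beta.BorderedHessian (diagK)
open Summit.QuantumFields.BalabanUV.Beta.AxialProjectorBlockMean (bmGaugeAt)
open Summit.QuantumFields.BalabanUV.Beta.AveragingWardRootedStencils (legSite)
open Summit.QuantumFields.BalabanUV.Beta.SymAveragingHessianCounts (symHessFFAt vertexFamily_symHessFFAt)
open Summit.QuantumFields.BalabanUV.Beta.SymCorrectorFaceGauge (l1_sub_legSite_le)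
open Summit.QuantumFields.BalabanUV.Beta.D1BFx.PackedKernelSplit (blk)
open Summit.QuantumFields.BalabanUV.Beta.D1BFx.PackedStraightColumnMixedMass (mass_blk_vertexOfM_K₀_le_of_vertexFamily)
open Summit.QuantumFields.BalabanUV.Beta.D1BFx.ColumnGaugeDefectRecord (abs_lockedWeight_record_le l1_ctr_le)
open Summit.QuantumFields.BalabanUV.Beta.D1BFx.DiagBracketWordMass (wmass_le_of_blk decay510_bracketWord_of_wmass)

/-! ## §1 The record: row (mcol) of the HEAD in mass currency, any bounded leg -/

section Record

variable (n : ℕ) [NeZero n]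

/-- [folklore] **THE UNIT COLUMN GENERATOR's SYMBOL THROUGH THE LEG, ENVELOPED FROM THE COARSE POINT**: for `1 ≤ n`,
`|bmGaugeAt ρ_c (colH K₀ n μ y) n (legSite ρ_c x b)| ≤ Gc(n)·e^{−r₀|x − n•y|₁}` with `r₀ = κ′∕(4n)` (`κ′ = κ₁₆₃(4)∕4`) and
`Gc(n) = (2∕n⁴)·(4·C₄·e^{κ′})·e^{r₀·(4n∕2)}` — leaf-01's locked weight letter `ColumnGaugeDefectRecord.abs_lockedWeight_record_le` divided by the lock scalar `n⁴∕2`, the leg's site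
within `|ρ_c|₁ ≤ 4n∕2` of `x` (TT10 `l1_sub_legSite_le`, leaf-01 `l1_ctr_le`). -/
theorem abs_unitColGen_legSite_le (hn : 1 ≤ n) (μ : Fin (3 + 1)) (y x : Site 4) (b : Fib 3) :
    |bmGaugeAt (ctr 4 n) (colH (KInvStep (d := 3) n 0) n μ y) n (legSite (ctr 4 n) x b)|
      ≤ (2 / (n : ℝ) ^ 4 * (4 * (MG163 (3 + 1) * periodConst (kappa163 (3 + 1)) 3) * Real.exp (kappa163 (3 + 1) / ((3 : ℝ) + 1)))
          * Real.exp (kappa163 (3 + 1) / ((3 : ℝ) + 1) / (((3 : ℝ) + 1) * n) * ((((3 : ℕ) : ℝ) + 1) * n / 2)))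
        * Real.exp (-(kappa163 (3 + 1) / ((3 : ℝ) + 1) / (((3 : ℝ) + 1) * n)) * l1 (x - (n : ℤ) • y)) := by
  set A : ℝ := 4 * (MG163 (3 + 1) * periodConst (kappa163 (3 + 1)) 3) * Real.exp (kappa163 (3 + 1) / ((3 : ℝ) + 1)) with hA
  set r₀ : ℝ := kappa163 (3 + 1) / ((3 : ℝ) + 1) / (((3 : ℝ) + 1) * n) with hr₀
  set w : Site 4 := legSite (ctr 4 n) x b with hw
  have hn0 : (0 : ℝ) < n := by exact_mod_cast hn
  have hn4 : (0 : ℝ) < (n : ℝ) ^ 4 / 2 := by positivity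
  have hr0 : 0 ≤ r₀ := by rw [hr₀]; have := kappa163_pos (3 + 1); positivity
  have hlock := abs_lockedWeight_record_le (n := n) hn μ y w
  rw [abs_mul, abs_of_pos hn4] at hlock
  -- the letter's constant is non-negative (it dominates a non-negative quantity up to a positive exponential)
  have hA0 : 0 ≤ A := by
    have h := (mul_nonneg hn4.le (abs_nonneg _)).trans hlock
    rw [← hA, ← hr₀] at h
    exact (mul_nonneg_iff_of_pos_right (Real.exp_pos _)).1 h
  -- divide by the lock scalar
  have h1 : |bmGaugeAt (ctr 4 n) (colH (KInvStep (d := 3) n 0) n μ y) n w| ≤ 2 / (n : ℝ) ^ 4 * A * Real.exp (-r₀ * l1 (w - (n : ℤ) • y)) := by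
    rw [← hA, ← hr₀] at hlock
    have h2 := (le_div_iff₀' hn4).2 hlock
    refine h2.trans (le_of_eq ?_)
    field_simp
  -- move the envelope from the leg's site `w` to `x`
  have hzw : l1 (x - w) ≤ l1 (ctr 4 n) := l1_sub_legSite_le (ctr 4 n) x b
  have hctr : l1 (ctr 4 n) ≤ ((((3 : ℕ) : ℝ) + 1) * n / 2) := l1_ctr_le 3 n
  have htri : l1 (x - (n : ℤ) • y) ≤ l1 (x - w) + l1 (w - (n : ℤ) • y) := l1_sub_triangle x w ((n : ℤ) • y)
  have hexp : Real.exp (-r₀ * l1 (w - (n : ℤ) • y))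
      ≤ Real.exp (r₀ * ((((3 : ℕ) : ℝ) + 1) * n / 2)) * Real.exp (-r₀ * l1 (x - (n : ℤ) • y)) := by
    rw [← Real.exp_add]
    exact Real.exp_le_exp.2 (by nlinarith)
  have hpos : 0 ≤ 2 / (n : ℝ) ^ 4 * A := by positivity
  calc |bmGaugeAt (ctr 4 n) (colH (KInvStep (d := 3) n 0) n μ y) n w|
      ≤ 2 / (n : ℝ) ^ 4 * A * Real.exp (-r₀ * l1 (w - (n : ℤ) • y)) := h1
    _ ≤ 2 / (n : ℝ) ^ 4 * A * (Real.exp (r₀ * ((((3 : ℕ) : ℝ) + 1) * n / 2)) * Real.exp (-r₀ * l1 (x - (n : ℤ) • y))) :=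
        mul_le_mul_of_nonneg_left hexp hpos
    _ = _ := by ring

/-- [folklore] **THE σ-WEIGHTED `ℓ¹` MASS OF `V_H = vertexOfM K₀ n (symHessFFAt ρ_c n) ν y′` AT ITS COARSE POINT** (modulo `hΦ`, `0 < κ₀`; `0 < σ ≤ κ₀∕(16n)`, any table rate
`δM` with `σ ≤ δM∕2`, `0 < δM`): summable and `≤ M_H(n) := 4 × [((n⁵)⁻¹(n³)⁻¹)·(4CΦe^{κ₀}e^{κ₀∕2}Zl 4(κ₀∕8))·(16·(2·ell(4,n)²·e^{4·4·n·δM})·Zl 4(δM∕2)²)]` — gan24-leaf-05 g61 C′'s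
`mass_blk_vertexOfM_K₀_le_of_vertexFamily` over an1's `vertexFamily_symHessFFAt` at the centred root, the four fibre blocks summed by §1. -/
theorem wmass_vertexOfM_K₀_symHessFFAt_le (hn : 1 ≤ n) {CΦ κ₀ : ℝ} (hκ₀ : 0 < κ₀)
    (hΦ : ∀ (ρ ν : Fin (3 + 1)) (w : Fin (3 + 1) → ℤ),
      |wΦ (N := n) ρ ν w| ≤ CΦ * ((n : ℝ) ^ 5)⁻¹ * ((n : ℝ) ^ 3)⁻¹ * Real.exp (-(κ₀ * supNorm w)))
    {σ δM : ℝ} (hσ : 0 < σ) (hσΦ : σ ≤ κ₀ / (16 * (n : ℝ))) (hδM : 0 < δM) (hσM : σ ≤ δM / 2) (ν : Fin (3 + 1)) (y' : Site 4) :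
    (Summable fun pr : Site 4 × Site 4 =>
        (∑ a : Fib 3, ∑ b : Fib 3, |vertexOfM (KInvStep (d := 3) n 0) n (symHessFFAt (ctr 4 n) n) ν y' pr.1 pr.2 a b|)
          * Real.exp (σ * (l1 (pr.1 - (n : ℤ) • y') + l1 (pr.2 - (n : ℤ) • y')))) ∧
      ∑' pr : Site 4 × Site 4,
          (∑ a : Fib 3, ∑ b : Fib 3, |vertexOfM (KInvStep (d := 3) n 0) n (symHessFFAt (ctr 4 n) n) ν y' pr.1 pr.2 a b|)
            * Real.exp (σ * (l1 (pr.1 - (n : ℤ) • y') + l1 (pr.2 - (n : ℤ) • y')))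
        ≤ 4 * ((((n : ℝ) ^ 5)⁻¹ * ((n : ℝ) ^ 3)⁻¹) * (4 * CΦ * Real.exp κ₀ * Real.exp (κ₀ / 2) * Zl 4 (κ₀ / 8))
            * (16 * (2 * (ell (3 + 1) n : ℝ) ^ 2 * Real.exp (4 * ((3 : ℝ) + 1) * n * δM)) * Zl 4 (δM / 2) ^ 2)) := by
  have hM := vertexFamily_symHessFFAt (d := 3) hn (ctrOff_mem_box hn) hδM.le
  have hblk := fun j k => mass_blk_vertexOfM_K₀_le_of_vertexFamily n hκ₀ hΦ hM hδM hσ.le hσΦ hσM ν y' j k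
  have h := wmass_le_of_blk (W := vertexOfM (KInvStep (d := 3) n 0) n (symHessFFAt (ctr 4 n) n) ν y')
    (fun q : Site 4 × Site 4 => Real.exp (σ * (l1 (q.1 - (n : ℤ) • y') + l1 (q.2 - (n : ℤ) • y'))))
    (B := fun _ _ => (((n : ℝ) ^ 5)⁻¹ * ((n : ℝ) ^ 3)⁻¹) * (4 * CΦ * Real.exp κ₀ * Real.exp (κ₀ / 2) * Zl 4 (κ₀ / 8))
      * (16 * (2 * (ell (3 + 1) n : ℝ) ^ 2 * Real.exp (4 * ((3 : ℝ) + 1) * n * δM)) * Zl 4 (δM / 2) ^ 2)) hblk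
  refine ⟨h.1, h.2.trans (le_of_eq ?_)⟩
  ring

/-- **ROW (mcol) IN MASS CURRENCY** [our objects + folklore] (modulo the DISPLAYED leg letter `Bdd G S`, `0 ≤ S`, and multiplier envelope `hΦ`, `0 < κ₀`; rates `0 < σ ≤ min (κ′∕(4n)) (κ₀∕(16n))`,
`σ ≤ δM∕2`, `0 < δM` — e.g. `σ := min (κ′∕(4n)) (κ₀∕(16n))`, `δM := 2σ`): for every pair of directions `(a, e)`, the HEAD's (mcol) word after `ChartDefectTwoPinsRest` (iii),
`z ↦ ½·tadpole G ((Λ′ e z∘V_H a 0 − V_H a 0∘Λ′ e z) + (Λ′ a 0∘V_H e z − V_H e z∘Λ′ a 0))` with `Λ′ μ y = diagK (x b ↦ bmGaugeAt ρ_c (colH K₀ n μ y) n (legSite ρ_c x b))`,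
`V_H = vertexOfM K₀ n (symHessFFAt ρ_c n)`, is `Decay510` with constant `½·(S·(2·Gc(n)·M_H(n) + 2·Gc(n)·M_H(n)))` and RATE `n·σ` (`= min (κ₁₆₃(4)∕64) (κ₀∕16)` at the suggested `σ`:
n-FREE).  LOCATED COUNT (zero weight): `Gc ≍ n⁻⁴`, `M_H ≍ n⁻⁸·n²·n⁸` ⇒ NET `≍ S·n⁻²`. -/
theorem decay510_row_mcol_mass (hn : 1 ≤ n) {G : MKer 4 (Fib 3)} {S : ℝ} (hG : Bdd G S) (hS : 0 ≤ S) {CΦ κ₀ : ℝ} (hκ₀ : 0 < κ₀)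
    (hΦ : ∀ (ρ ν : Fin (3 + 1)) (w : Fin (3 + 1) → ℤ),
      |wΦ (N := n) ρ ν w| ≤ CΦ * ((n : ℝ) ^ 5)⁻¹ * ((n : ℝ) ^ 3)⁻¹ * Real.exp (-(κ₀ * supNorm w)))
    {σ δM : ℝ} (hσ : 0 < σ) (hσr : σ ≤ kappa163 (3 + 1) / ((3 : ℝ) + 1) / (((3 : ℝ) + 1) * n)) (hσΦ : σ ≤ κ₀ / (16 * (n : ℝ)))
    (hδM : 0 < δM) (hσM : σ ≤ δM / 2) (a e : Fin (3 + 1)) :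
    Decay510 (fun z : Site 4 => (1 / 2 : ℝ) * tadpole G
        ((comp (diagK fun x b => bmGaugeAt (ctr 4 n) (colH (KInvStep (d := 3) n 0) n e z) n (legSite (ctr 4 n) x b))
              (vertexOfM (KInvStep (d := 3) n 0) n (symHessFFAt (ctr 4 n) n) a 0)
            - comp (vertexOfM (KInvStep (d := 3) n 0) n (symHessFFAt (ctr 4 n) n) a 0)
              (diagK fun x b => bmGaugeAt (ctr 4 n) (colH (KInvStep (d := 3) n 0) n e z) n (legSite (ctr 4 n) x b)))
          + (comp (diagK fun x b => bmGaugeAt (ctr 4 n) (colH (KInvStep (d := 3) n 0) n a 0) n (legSite (ctr 4 n) x b))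
              (vertexOfM (KInvStep (d := 3) n 0) n (symHessFFAt (ctr 4 n) n) e z)
            - comp (vertexOfM (KInvStep (d := 3) n 0) n (symHessFFAt (ctr 4 n) n) e z)
              (diagK fun x b => bmGaugeAt (ctr 4 n) (colH (KInvStep (d := 3) n 0) n a 0) n (legSite (ctr 4 n) x b)))))
      ((1 / 2 : ℝ) * (S * (2 * ((2 / (n : ℝ) ^ 4 * (4 * (MG163 (3 + 1) * periodConst (kappa163 (3 + 1)) 3) * Real.exp (kappa163 (3 + 1) / ((3 : ℝ) + 1)))
              * Real.exp (kappa163 (3 + 1) / ((3 : ℝ) + 1) / (((3 : ℝ) + 1) * n) * ((((3 : ℕ) : ℝ) + 1) * n / 2))))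
            * (4 * ((((n : ℝ) ^ 5)⁻¹ * ((n : ℝ) ^ 3)⁻¹) * (4 * CΦ * Real.exp κ₀ * Real.exp (κ₀ / 2) * Zl 4 (κ₀ / 8))
              * (16 * (2 * (ell (3 + 1) n : ℝ) ^ 2 * Real.exp (4 * ((3 : ℝ) + 1) * n * δM)) * Zl 4 (δM / 2) ^ 2)))
          + 2 * ((2 / (n : ℝ) ^ 4 * (4 * (MG163 (3 + 1) * periodConst (kappa163 (3 + 1)) 3) * Real.exp (kappa163 (3 + 1) / ((3 : ℝ) + 1)))
              * Real.exp (kappa163 (3 + 1) / ((3 : ℝ) + 1) / (((3 : ℝ) + 1) * n) * ((((3 : ℕ) : ℝ) + 1) * n / 2))))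
            * (4 * ((((n : ℝ) ^ 5)⁻¹ * ((n : ℝ) ^ 3)⁻¹) * (4 * CΦ * Real.exp κ₀ * Real.exp (κ₀ / 2) * Zl 4 (κ₀ / 8))
              * (16 * (2 * (ell (3 + 1) n : ℝ) ^ 2 * Real.exp (4 * ((3 : ℝ) + 1) * n * δM)) * Zl 4 (δM / 2) ^ 2))))))
      ((n : ℝ) * σ) := by
  set Gc : ℝ := (2 / (n : ℝ) ^ 4 * (4 * (MG163 (3 + 1) * periodConst (kappa163 (3 + 1)) 3) * Real.exp (kappa163 (3 + 1) / ((3 : ℝ) + 1)))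
      * Real.exp (kappa163 (3 + 1) / ((3 : ℝ) + 1) / (((3 : ℝ) + 1) * n) * ((((3 : ℕ) : ℝ) + 1) * n / 2))) with hGc
  set MH : ℝ := 4 * ((((n : ℝ) ^ 5)⁻¹ * ((n : ℝ) ^ 3)⁻¹) * (4 * CΦ * Real.exp κ₀ * Real.exp (κ₀ / 2) * Zl 4 (κ₀ / 8))
      * (16 * (2 * (ell (3 + 1) n : ℝ) ^ 2 * Real.exp (4 * ((3 : ℝ) + 1) * n * δM)) * Zl 4 (δM / 2) ^ 2)) with hMH
  have hGc0 : 0 ≤ Gc := by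
    have h := (abs_nonneg _).trans (abs_unitColGen_legSite_le n hn a 0 0 (Sum.inl 0))
    rw [← hGc] at h
    exact (mul_nonneg_iff_of_pos_right (Real.exp_pos _)).1 h
  -- the two symbol families, enveloped at the common rate `σ ≤ r₀`
  have hg : ∀ (μ : Fin (3 + 1)) (y x : Site 4) (b : Fib 3),
      |bmGaugeAt (ctr 4 n) (colH (KInvStep (d := 3) n 0) n μ y) n (legSite (ctr 4 n) x b)| ≤ Gc * Real.exp (-σ * l1 (x - (n : ℤ) • y)) := by
    intro μ y x b
    refine (abs_unitColGen_legSite_le n hn μ y x b).trans ?_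
    rw [← hGc]
    refine mul_le_mul_of_nonneg_left (Real.exp_le_exp.2 ?_) hGc0
    have h0 : 0 ≤ l1 (x - (n : ℤ) • y) := l1_nonneg _
    nlinarith
  have hV := fun (ν : Fin (3 + 1)) (y : Site 4) => wmass_vertexOfM_K₀_symHessFFAt_le n hn hκ₀ hΦ hσ hσΦ hδM hσM ν y
  have h := decay510_bracketWord_of_wmass (d := 3) hG hS n
    (gA := fun y x b => bmGaugeAt (ctr 4 n) (colH (KInvStep (d := 3) n 0) n a y) n (legSite (ctr 4 n) x b))
    (gE := fun y x b => bmGaugeAt (ctr 4 n) (colH (KInvStep (d := 3) n 0) n e y) n (legSite (ctr 4 n) x b))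
    hGc0 hσ.le (fun y x b => hg a y x b) (fun y x b => hg e y x b)
    (VA := fun y => vertexOfM (KInvStep (d := 3) n 0) n (symHessFFAt (ctr 4 n) n) a y)
    (VE := fun y => vertexOfM (KInvStep (d := 3) n 0) n (symHessFFAt (ctr 4 n) n) e y)
    (σ := σ) (MV := MH) le_rfl (fun y => hV a y) (fun y => hV e y) (1 / 2)
  rw [abs_of_pos (by norm_num : (0 : ℝ) < 1 / 2)] at h
  exact h

/-- **ROW (mcol) IN THE HEAD's BINDER SHAPES** (`ChartDefectHead.abs_secondMoment_chartDefect_le_of_rows`' `hAmcol ∕ hBmcol` after `ChartDefectTwoPinsRest` (iii); same displayed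
letters as `decay510_row_mcol_mass`): (i) `∀ a e, AbsMoment₂ (Wmcol a e)`; (ii) `|secondMoment Wmcol μ ν| ≤ C_mcol·Σ'_x |x|₁² e^{−(n·σ)|x|₁}` — lit `absMoment₂_of_decay510` +
`secondMoment_abs_le_of_decay510`.  The `n`-laws of `S` and `CΦ` are NOT claimed. -/
theorem row_mcol_mass (hn : 1 ≤ n) {G : MKer 4 (Fib 3)} {S : ℝ} (hG : Bdd G S) (hS : 0 ≤ S) {CΦ κ₀ : ℝ} (hκ₀ : 0 < κ₀)
    (hΦ : ∀ (ρ ν : Fin (3 + 1)) (w : Fin (3 + 1) → ℤ),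
      |wΦ (N := n) ρ ν w| ≤ CΦ * ((n : ℝ) ^ 5)⁻¹ * ((n : ℝ) ^ 3)⁻¹ * Real.exp (-(κ₀ * supNorm w)))
    {σ δM : ℝ} (hσ : 0 < σ) (hσr : σ ≤ kappa163 (3 + 1) / ((3 : ℝ) + 1) / (((3 : ℝ) + 1) * n)) (hσΦ : σ ≤ κ₀ / (16 * (n : ℝ)))
    (hδM : 0 < δM) (hσM : σ ≤ δM / 2) (μ ν : Fin (3 + 1)) :
    (∀ a e : Fin (3 + 1), AbsMoment₂ (fun z : Site 4 => (1 / 2 : ℝ) * tadpole G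
        ((comp (diagK fun x b => bmGaugeAt (ctr 4 n) (colH (KInvStep (d := 3) n 0) n e z) n (legSite (ctr 4 n) x b))
              (vertexOfM (KInvStep (d := 3) n 0) n (symHessFFAt (ctr 4 n) n) a 0)
            - comp (vertexOfM (KInvStep (d := 3) n 0) n (symHessFFAt (ctr 4 n) n) a 0)
              (diagK fun x b => bmGaugeAt (ctr 4 n) (colH (KInvStep (d := 3) n 0) n e z) n (legSite (ctr 4 n) x b)))
          + (comp (diagK fun x b => bmGaugeAt (ctr 4 n) (colH (KInvStep (d := 3) n 0) n a 0) n (legSite (ctr 4 n) x b))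
              (vertexOfM (KInvStep (d := 3) n 0) n (symHessFFAt (ctr 4 n) n) e z)
            - comp (vertexOfM (KInvStep (d := 3) n 0) n (symHessFFAt (ctr 4 n) n) e z)
              (diagK fun x b => bmGaugeAt (ctr 4 n) (colH (KInvStep (d := 3) n 0) n a 0) n (legSite (ctr 4 n) x b)))))) ∧
      |B12Beta.secondMoment (fun (a e : Fin (3 + 1)) (z : Site 4) => (1 / 2 : ℝ) * tadpole G
          ((comp (diagK fun x b => bmGaugeAt (ctr 4 n) (colH (KInvStep (d := 3) n 0) n e z) n (legSite (ctr 4 n) x b))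
                (vertexOfM (KInvStep (d := 3) n 0) n (symHessFFAt (ctr 4 n) n) a 0)
              - comp (vertexOfM (KInvStep (d := 3) n 0) n (symHessFFAt (ctr 4 n) n) a 0)
                (diagK fun x b => bmGaugeAt (ctr 4 n) (colH (KInvStep (d := 3) n 0) n e z) n (legSite (ctr 4 n) x b)))
            + (comp (diagK fun x b => bmGaugeAt (ctr 4 n) (colH (KInvStep (d := 3) n 0) n a 0) n (legSite (ctr 4 n) x b))
                (vertexOfM (KInvStep (d := 3) n 0) n (symHessFFAt (ctr 4 n) n) e z)
              - comp (vertexOfM (KInvStep (d := 3) n 0) n (symHessFFAt (ctr 4 n) n) e z)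
                (diagK fun x b => bmGaugeAt (ctr 4 n) (colH (KInvStep (d := 3) n 0) n a 0) n (legSite (ctr 4 n) x b))))) μ ν|
        ≤ ((1 / 2 : ℝ) * (S * (2 * ((2 / (n : ℝ) ^ 4 * (4 * (MG163 (3 + 1) * periodConst (kappa163 (3 + 1)) 3) * Real.exp (kappa163 (3 + 1) / ((3 : ℝ) + 1)))
                * Real.exp (kappa163 (3 + 1) / ((3 : ℝ) + 1) / (((3 : ℝ) + 1) * n) * ((((3 : ℕ) : ℝ) + 1) * n / 2))))
              * (4 * ((((n : ℝ) ^ 5)⁻¹ * ((n : ℝ) ^ 3)⁻¹) * (4 * CΦ * Real.exp κ₀ * Real.exp (κ₀ / 2) * Zl 4 (κ₀ / 8))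
                * (16 * (2 * (ell (3 + 1) n : ℝ) ^ 2 * Real.exp (4 * ((3 : ℝ) + 1) * n * δM)) * Zl 4 (δM / 2) ^ 2)))
            + 2 * ((2 / (n : ℝ) ^ 4 * (4 * (MG163 (3 + 1) * periodConst (kappa163 (3 + 1)) 3) * Real.exp (kappa163 (3 + 1) / ((3 : ℝ) + 1)))
                * Real.exp (kappa163 (3 + 1) / ((3 : ℝ) + 1) / (((3 : ℝ) + 1) * n) * ((((3 : ℕ) : ℝ) + 1) * n / 2))))
              * (4 * ((((n : ℝ) ^ 5)⁻¹ * ((n : ℝ) ^ 3)⁻¹) * (4 * CΦ * Real.exp κ₀ * Real.exp (κ₀ / 2) * Zl 4 (κ₀ / 8))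
                * (16 * (2 * (ell (3 + 1) n : ℝ) ^ 2 * Real.exp (4 * ((3 : ℝ) + 1) * n * δM)) * Zl 4 (δM / 2) ^ 2))))))
          * ∑' x : Site 4, l1 x ^ 2 * Real.exp (-((n : ℝ) * σ) * l1 x) := by
  have hrate : 0 < (n : ℝ) * σ := mul_pos (by exact_mod_cast hn) hσ
  have hd := fun a e => decay510_row_mcol_mass n hn hG hS hκ₀ hΦ hσ hσr hσΦ hδM hσM a e
  refine ⟨fun a e => absMoment₂_of_decay510 hrate (hd a e), ?_⟩
  exact (secondMoment_abs_le_of_decay510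
    (P := fun (a e : Fin (3 + 1)) (z : Site 4) => (1 / 2 : ℝ) * tadpole G
        ((comp (diagK fun x b => bmGaugeAt (ctr 4 n) (colH (KInvStep (d := 3) n 0) n e z) n (legSite (ctr 4 n) x b))
              (vertexOfM (KInvStep (d := 3) n 0) n (symHessFFAt (ctr 4 n) n) a 0)
            - comp (vertexOfM (KInvStep (d := 3) n 0) n (symHessFFAt (ctr 4 n) n) a 0)
              (diagK fun x b => bmGaugeAt (ctr 4 n) (colH (KInvStep (d := 3) n 0) n e z) n (legSite (ctr 4 n) x b)))
          + (comp (diagK fun x b => bmGaugeAt (ctr 4 n) (colH (KInvStep (d := 3) n 0) n a 0) n (legSite (ctr 4 n) x b))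
              (vertexOfM (KInvStep (d := 3) n 0) n (symHessFFAt (ctr 4 n) n) e z)
            - comp (vertexOfM (KInvStep (d := 3) n 0) n (symHessFFAt (ctr 4 n) n) e z)
              (diagK fun x b => bmGaugeAt (ctr 4 n) (colH (KInvStep (d := 3) n 0) n a 0) n (legSite (ctr 4 n) x b))))) hrate (hd μ ν)).2

omit [NeZero n] in
/-- [folklore] At the suggested rate the `Decay510` rate is `n`-free: `n·min (κ′∕(4n)) (κ₀∕(16n)) = min (κ′∕4) (κ₀∕16)` (`κ′ = κ₁₆₃(4)∕4`). -/
theorem rate_nfree (hn : 1 ≤ n) (κ₀ : ℝ) :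
    (n : ℝ) * min (kappa163 (3 + 1) / ((3 : ℝ) + 1) / (((3 : ℝ) + 1) * n)) (κ₀ / (16 * (n : ℝ)))
      = min (kappa163 (3 + 1) / ((3 : ℝ) + 1) / ((3 : ℝ) + 1)) (κ₀ / 16) := by
  have hn0 : (0 : ℝ) < n := by exact_mod_cast hn
  rw [mul_min_of_nonneg _ _ hn0.le]
  congr 1 <;> field_simp

/-! ## §2 (v1.2, APPENDED) The same row with the vertex mass a BINDER — TT27a's `hVA ∕ hVE` socket exposed at the record -/

/-- **ROW (mcol) IN MASS CURRENCY, ANY BOUNDED LEG, ANY VERTEX-MASS LETTER** [our objects + folklore] (v1.2; modulo `Bdd G S`, `0 ≤ S`; rate `0 < σ ≤ r₀ = κ₁₆₃(4)∕4∕(4n)`; BINDER `hV`: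
the `σ`-weighted `ℓ¹` mass about `n•y'` of `V ν y' := vertexOfM K₀ n (symHessFFAt ρ_c n) ν y'` is `≤ MV` — TT27a's socket verbatim, taken BY TERM by §1's `wmass_vertexOfM_K₀_symHessFFAt_le`
(g61's `Zl` route: then this is `decay510_row_mcol_mass`) or by gan24-leaf-05 g63's «H-TABLE-MASS» `SymHessTablePairMass` letter (no `Zl²`; their junction probe rc 0)): for every `(a, e)`,
`Decay510 (z ↦ ½·tadpole G (W^{G,col}_{K₀}(a,e;z))) (½·(S·(2·Gc(n)·MV + 2·Gc(n)·MV))) (n·σ)` — TT27a `decay510_bracketWord_of_wmass` over `abs_unitColGen_legSite_le`. -/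
theorem decay510_row_mcol_mass_of_wmass (hn : 1 ≤ n) {G : MKer 4 (Fib 3)} {S : ℝ} (hG : Bdd G S) (hS : 0 ≤ S)
    {σ MV : ℝ} (hσ : 0 < σ) (hσr : σ ≤ kappa163 (3 + 1) / ((3 : ℝ) + 1) / (((3 : ℝ) + 1) * n))
    (hV : ∀ (ν : Fin (3 + 1)) (y' : Site 4), (Summable fun pr : Site 4 × Site 4 =>
        (∑ a : Fib 3, ∑ b : Fib 3, |vertexOfM (KInvStep (d := 3) n 0) n (symHessFFAt (ctr 4 n) n) ν y' pr.1 pr.2 a b|)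
          * Real.exp (σ * (l1 (pr.1 - (n : ℤ) • y') + l1 (pr.2 - (n : ℤ) • y')))) ∧
      ∑' pr : Site 4 × Site 4,
          (∑ a : Fib 3, ∑ b : Fib 3, |vertexOfM (KInvStep (d := 3) n 0) n (symHessFFAt (ctr 4 n) n) ν y' pr.1 pr.2 a b|)
            * Real.exp (σ * (l1 (pr.1 - (n : ℤ) • y') + l1 (pr.2 - (n : ℤ) • y'))) ≤ MV)
    (a e : Fin (3 + 1)) :
    Decay510 (fun z : Site 4 => (1 / 2 : ℝ) * tadpole G
        ((comp (diagK fun x b => bmGaugeAt (ctr 4 n) (colH (KInvStep (d := 3) n 0) n e z) n (legSite (ctr 4 n) x b))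
              (vertexOfM (KInvStep (d := 3) n 0) n (symHessFFAt (ctr 4 n) n) a 0)
            - comp (vertexOfM (KInvStep (d := 3) n 0) n (symHessFFAt (ctr 4 n) n) a 0)
              (diagK fun x b => bmGaugeAt (ctr 4 n) (colH (KInvStep (d := 3) n 0) n e z) n (legSite (ctr 4 n) x b)))
          + (comp (diagK fun x b => bmGaugeAt (ctr 4 n) (colH (KInvStep (d := 3) n 0) n a 0) n (legSite (ctr 4 n) x b))
              (vertexOfM (KInvStep (d := 3) n 0) n (symHessFFAt (ctr 4 n) n) e z)
            - comp (vertexOfM (KInvStep (d := 3) n 0) n (symHessFFAt (ctr 4 n) n) e z)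
              (diagK fun x b => bmGaugeAt (ctr 4 n) (colH (KInvStep (d := 3) n 0) n a 0) n (legSite (ctr 4 n) x b)))))
      ((1 / 2 : ℝ) * (S * (2 * ((2 / (n : ℝ) ^ 4 * (4 * (MG163 (3 + 1) * periodConst (kappa163 (3 + 1)) 3) * Real.exp (kappa163 (3 + 1) / ((3 : ℝ) + 1)))
              * Real.exp (kappa163 (3 + 1) / ((3 : ℝ) + 1) / (((3 : ℝ) + 1) * n) * ((((3 : ℕ) : ℝ) + 1) * n / 2)))) * MV
          + 2 * ((2 / (n : ℝ) ^ 4 * (4 * (MG163 (3 + 1) * periodConst (kappa163 (3 + 1)) 3) * Real.exp (kappa163 (3 + 1) / ((3 : ℝ) + 1)))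
              * Real.exp (kappa163 (3 + 1) / ((3 : ℝ) + 1) / (((3 : ℝ) + 1) * n) * ((((3 : ℕ) : ℝ) + 1) * n / 2)))) * MV))) ((n : ℝ) * σ) := by
  set Gc : ℝ := (2 / (n : ℝ) ^ 4 * (4 * (MG163 (3 + 1) * periodConst (kappa163 (3 + 1)) 3) * Real.exp (kappa163 (3 + 1) / ((3 : ℝ) + 1)))
      * Real.exp (kappa163 (3 + 1) / ((3 : ℝ) + 1) / (((3 : ℝ) + 1) * n) * ((((3 : ℕ) : ℝ) + 1) * n / 2))) with hGc
  have hGc0 : 0 ≤ Gc := by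
    have h := (abs_nonneg _).trans (abs_unitColGen_legSite_le n hn a 0 0 (Sum.inl 0))
    rw [← hGc] at h
    exact (mul_nonneg_iff_of_pos_right (Real.exp_pos _)).1 h
  -- the two symbol families, enveloped at the common rate `σ ≤ r₀`
  have hg : ∀ (μ : Fin (3 + 1)) (y x : Site 4) (b : Fib 3),
      |bmGaugeAt (ctr 4 n) (colH (KInvStep (d := 3) n 0) n μ y) n (legSite (ctr 4 n) x b)| ≤ Gc * Real.exp (-σ * l1 (x - (n : ℤ) • y)) := by
    intro μ y x b
    refine (abs_unitColGen_legSite_le n hn μ y x b).trans ?_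
    rw [← hGc]
    refine mul_le_mul_of_nonneg_left (Real.exp_le_exp.2 ?_) hGc0
    have h0 : 0 ≤ l1 (x - (n : ℤ) • y) := l1_nonneg _
    nlinarith
  have h := decay510_bracketWord_of_wmass (d := 3) hG hS n
    (gA := fun y x b => bmGaugeAt (ctr 4 n) (colH (KInvStep (d := 3) n 0) n a y) n (legSite (ctr 4 n) x b))
    (gE := fun y x b => bmGaugeAt (ctr 4 n) (colH (KInvStep (d := 3) n 0) n e y) n (legSite (ctr 4 n) x b))
    hGc0 hσ.le (fun y x b => hg a y x b) (fun y x b => hg e y x b)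
    (VA := fun y => vertexOfM (KInvStep (d := 3) n 0) n (symHessFFAt (ctr 4 n) n) a y)
    (VE := fun y => vertexOfM (KInvStep (d := 3) n 0) n (symHessFFAt (ctr 4 n) n) e y)
    (σ := σ) (MV := MV) le_rfl (fun y => hV a y) (fun y => hV e y) (1 / 2)
  rw [abs_of_pos (by norm_num : (0 : ℝ) < 1 / 2)] at h
  exact h

/-- **ROW (mcol) IN THE HEAD's BINDER SHAPES, ANY VERTEX-MASS LETTER** (v1.2; `hAmcol ∕ hBmcol` after `ChartDefectTwoPinsRest` (iii); displayed letters as `decay510_row_mcol_mass_of_wmass`):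
(i) `∀ a e, AbsMoment₂ (Wmcol a e)`; (ii) `|secondMoment Wmcol μ ν| ≤ C_mcol(MV)·Σ'_x |x|₁² e^{−(n·σ)|x|₁}` — lit `absMoment₂_of_decay510` + `secondMoment_abs_le_of_decay510`. -/
theorem row_mcol_mass_of_wmass (hn : 1 ≤ n) {G : MKer 4 (Fib 3)} {S : ℝ} (hG : Bdd G S) (hS : 0 ≤ S)
    {σ MV : ℝ} (hσ : 0 < σ) (hσr : σ ≤ kappa163 (3 + 1) / ((3 : ℝ) + 1) / (((3 : ℝ) + 1) * n))
    (hV : ∀ (ν : Fin (3 + 1)) (y' : Site 4), (Summable fun pr : Site 4 × Site 4 =>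
        (∑ a : Fib 3, ∑ b : Fib 3, |vertexOfM (KInvStep (d := 3) n 0) n (symHessFFAt (ctr 4 n) n) ν y' pr.1 pr.2 a b|)
          * Real.exp (σ * (l1 (pr.1 - (n : ℤ) • y') + l1 (pr.2 - (n : ℤ) • y')))) ∧
      ∑' pr : Site 4 × Site 4,
          (∑ a : Fib 3, ∑ b : Fib 3, |vertexOfM (KInvStep (d := 3) n 0) n (symHessFFAt (ctr 4 n) n) ν y' pr.1 pr.2 a b|)
            * Real.exp (σ * (l1 (pr.1 - (n : ℤ) • y') + l1 (pr.2 - (n : ℤ) • y'))) ≤ MV)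
    (μ ν : Fin (3 + 1)) :
    (∀ a e : Fin (3 + 1), AbsMoment₂ (fun z : Site 4 => (1 / 2 : ℝ) * tadpole G
        ((comp (diagK fun x b => bmGaugeAt (ctr 4 n) (colH (KInvStep (d := 3) n 0) n e z) n (legSite (ctr 4 n) x b))
              (vertexOfM (KInvStep (d := 3) n 0) n (symHessFFAt (ctr 4 n) n) a 0)
            - comp (vertexOfM (KInvStep (d := 3) n 0) n (symHessFFAt (ctr 4 n) n) a 0)
              (diagK fun x b => bmGaugeAt (ctr 4 n) (colH (KInvStep (d := 3) n 0) n e z) n (legSite (ctr 4 n) x b)))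
          + (comp (diagK fun x b => bmGaugeAt (ctr 4 n) (colH (KInvStep (d := 3) n 0) n a 0) n (legSite (ctr 4 n) x b))
              (vertexOfM (KInvStep (d := 3) n 0) n (symHessFFAt (ctr 4 n) n) e z)
            - comp (vertexOfM (KInvStep (d := 3) n 0) n (symHessFFAt (ctr 4 n) n) e z)
              (diagK fun x b => bmGaugeAt (ctr 4 n) (colH (KInvStep (d := 3) n 0) n a 0) n (legSite (ctr 4 n) x b)))))) ∧
      |B12Beta.secondMoment (fun (a e : Fin (3 + 1)) (z : Site 4) => (1 / 2 : ℝ) * tadpole G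
          ((comp (diagK fun x b => bmGaugeAt (ctr 4 n) (colH (KInvStep (d := 3) n 0) n e z) n (legSite (ctr 4 n) x b))
                (vertexOfM (KInvStep (d := 3) n 0) n (symHessFFAt (ctr 4 n) n) a 0)
              - comp (vertexOfM (KInvStep (d := 3) n 0) n (symHessFFAt (ctr 4 n) n) a 0)
                (diagK fun x b => bmGaugeAt (ctr 4 n) (colH (KInvStep (d := 3) n 0) n e z) n (legSite (ctr 4 n) x b)))
            + (comp (diagK fun x b => bmGaugeAt (ctr 4 n) (colH (KInvStep (d := 3) n 0) n a 0) n (legSite (ctr 4 n) x b))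
                (vertexOfM (KInvStep (d := 3) n 0) n (symHessFFAt (ctr 4 n) n) e z)
              - comp (vertexOfM (KInvStep (d := 3) n 0) n (symHessFFAt (ctr 4 n) n) e z)
                (diagK fun x b => bmGaugeAt (ctr 4 n) (colH (KInvStep (d := 3) n 0) n a 0) n (legSite (ctr 4 n) x b))))) μ ν|
        ≤ ((1 / 2 : ℝ) * (S * (2 * ((2 / (n : ℝ) ^ 4 * (4 * (MG163 (3 + 1) * periodConst (kappa163 (3 + 1)) 3) * Real.exp (kappa163 (3 + 1) / ((3 : ℝ) + 1)))
              * Real.exp (kappa163 (3 + 1) / ((3 : ℝ) + 1) / (((3 : ℝ) + 1) * n) * ((((3 : ℕ) : ℝ) + 1) * n / 2)))) * MV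
          + 2 * ((2 / (n : ℝ) ^ 4 * (4 * (MG163 (3 + 1) * periodConst (kappa163 (3 + 1)) 3) * Real.exp (kappa163 (3 + 1) / ((3 : ℝ) + 1)))
              * Real.exp (kappa163 (3 + 1) / ((3 : ℝ) + 1) / (((3 : ℝ) + 1) * n) * ((((3 : ℕ) : ℝ) + 1) * n / 2)))) * MV)))
          * ∑' x : Site 4, l1 x ^ 2 * Real.exp (-((n : ℝ) * σ) * l1 x) := by
  have hrate : 0 < (n : ℝ) * σ := mul_pos (by exact_mod_cast hn) hσ
  have hd := fun a e => decay510_row_mcol_mass_of_wmass n hn hG hS hσ hσr hV a e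
  refine ⟨fun a e => absMoment₂_of_decay510 hrate (hd a e), ?_⟩
  exact (secondMoment_abs_le_of_decay510
    (P := fun (a e : Fin (3 + 1)) (z : Site 4) => (1 / 2 : ℝ) * tadpole G
        ((comp (diagK fun x b => bmGaugeAt (ctr 4 n) (colH (KInvStep (d := 3) n 0) n e z) n (legSite (ctr 4 n) x b))
              (vertexOfM (KInvStep (d := 3) n 0) n (symHessFFAt (ctr 4 n) n) a 0)
            - comp (vertexOfM (KInvStep (d := 3) n 0) n (symHessFFAt (ctr 4 n) n) a 0)
              (diagK fun x b => bmGaugeAt (ctr 4 n) (colH (KInvStep (d := 3) n 0) n e z) n (legSite (ctr 4 n) x b)))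
          + (comp (diagK fun x b => bmGaugeAt (ctr 4 n) (colH (KInvStep (d := 3) n 0) n a 0) n (legSite (ctr 4 n) x b))
              (vertexOfM (KInvStep (d := 3) n 0) n (symHessFFAt (ctr 4 n) n) e z)
            - comp (vertexOfM (KInvStep (d := 3) n 0) n (symHessFFAt (ctr 4 n) n) e z)
              (diagK fun x b => bmGaugeAt (ctr 4 n) (colH (KInvStep (d := 3) n 0) n a 0) n (legSite (ctr 4 n) x b))))) hrate (hd μ ν)).2

end Record

end Summit.QuantumFields.BalabanUV.Beta.D1BFx.ChartDefectRowMcolMass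

end
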